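import Mathlib
import Summits.ResolutionOfSingularities.ResolutionOfSingularities.Theorems.WildQuotientsWildQuotientResolutionStubQuotientModelNormal
import Summits.ResolutionOfSingularities.ResolutionOfSingularities.Theorems.WildQuotientsWildQuotientResolutionQuotientPhaseZeroNormal
import HarnessLib

/-!
# Phase 0 with a NORMAL model, stated on the crux's own data, conditional on Abbes–Saito 2011 Prop. 2.22
# (crux `WildQuotients.WildQuotientResolution`, stub `stub_phaseZeroHighDim`)

Crux stmt-ResolutionOfSingularities-15640 (`WildQuotientResolution`), line `Sketch`, registered stub
`stub_phaseZeroHighDim`. The wrapper of ✓`QuotientPhaseZeroNormal.exists_admissibleBlowup_glued_forall_hasNormalSylow`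
in the crux's variables: `k` a field of characteristic `ℓ`, `f : X₁ → Spec k` separated of finite type,
`q : X′ → X₁` FINITE and `G`-invariant for a FAITHFUL action `ρ` of the finite group `G` on the NORMAL
integral `X′` (the stub has `X′` regular). Conditional on the typed named fact AS2011 Prop. 2.22, we get:
the quotient `q_G : X′ → Y₁ = X′/G` over `k` (affine, surjective, `G`-invariant, fibres the orbits, `Y₁`
locally of finite type over `k`, `q_G ≫ s_Y = q ≫ f`), a dense open `W ⊆ Y₁` with `q_G|_W` étale, the
restricted action `ρW` on `q_G⁻¹W`, a `W`-admissible blow-up `φ : Y₁′ → Y₁`, the equivariant lift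
`f′ : q_G⁻¹W → Y₁′`, and p-closed inertia at every point of `f′.normalization` — the normal Phase-0 model.
Ingredients: Mumford's cover `q⁻¹U` (✓`exists_stableAffineOpens_mem`), normality of `X′/G`
(✓`QuotientModelNormal.isIntegrallyClosed_stalk_glued_of_stalk`), generic étaleness
(✓`exists_dense_etale_gluedMk_morphismRestrict`, faithfulness).

[OURS · crux stmt-ResolutionOfSingularities-15640 · helper toward `stub_phaseZeroHighDim`, CONDITIONAL on the
named fact AS2011 Prop. 2.22; counted 0; AI-level work, weaker than expert review.]
-/

-- single-problem summit: the doubled namespace component `ResolutionOfSingularities` is forced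
set_option linter.dupNamespace false

noncomputable section

open CategoryTheory CategoryTheory.Limits AlgebraicGeometry TopologicalSpace
open Literature.AlgebraicGeometry.Ramification Literature.AlgebraicGeometry.RelativeSpec
open Literature.AlgebraicGeometry.Resolution

namespace Summit.ResolutionOfSingularities.ResolutionOfSingularities.Theorems.WildQuotientResolution.QuotientPhaseZeroNormal

set_option backward.isDefEq.respectTransparency false

set_option maxHeartbeats 800000 in
/-- **Phase 0 with a normal model for the crux data, conditional on AS2011 Prop. 2.22** (see the module
docstring for the list of conjuncts). [cite: AbbesSaito2011, Prop. 2.22 (NS4), 2.3, Def. 2.12]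
[cite: SGA1, Exp. V, Prop. 1.8, 2.6] [cite: MumfordAV1970, §7 Thm. p. 66] -/
theorem exists_quotient_admissibleBlowup_forall_hasNormalSylow
    (hAS : AbbesSaito2011_inertiaNormalSylow_after_admissibleBlowup.{0})
    (ℓ : ℕ) [Fact ℓ.Prime] (k : Type) [Field k] [CharP k ℓ]
    (X' X₁ : Scheme.{0}) (f : X₁ ⟶ Spec (.of k)) (q : X' ⟶ X₁) (G : Type) [Group G] [Finite G]
    (ρ : G →* Aut X') (hfaith : Function.Injective ρ)
    [IsSeparated f] [LocallyOfFiniteType f] [QuasiCompact f] [IsIntegral X'] [IsFinite q]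
    (hnorm : ∀ x : X', IsIntegrallyClosed (X'.presheaf.stalk x))
    (hρ : ∀ g : G, (ρ g).hom ≫ q = q) :
    ∃ (Y₁ : Scheme.{0}) (sY : Y₁ ⟶ Spec (.of k)) (qG : X' ⟶ Y₁) (W : Y₁.Opens)
      (ρW : G →* Aut ((qG ⁻¹ᵁ W : X'.Opens) : Scheme.{0})),
      LocallyOfFiniteType sY ∧ IsAffineHom qG ∧ Function.Surjective qG ∧ qG ≫ sY = q ≫ f ∧
      (∀ g : G, (ρ g).hom ≫ qG = qG) ∧
      (∀ x y : X', qG x = qG y → ∃ g : G, (ρ g).hom x = y) ∧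
      (∀ y : Y₁, IsIntegrallyClosed (Y₁.presheaf.stalk y)) ∧
      Dense (W : Set Y₁) ∧ Etale (qG ∣_ W) ∧
      (∀ g : G, (ρW g).hom ≫ (qG ⁻¹ᵁ W).ι = (qG ⁻¹ᵁ W).ι ≫ (ρ g).hom) ∧
      ∃ (Y₁' : Scheme.{0}) (φ : Y₁' ⟶ Y₁) (I : Y₁.IdealSheafData),
        IsBlowup φ I ∧ (∀ U : Y₁.affineOpens, (I.ideal U).FG) ∧
        Disjoint (W : Set Y₁) (I.support : Set Y₁) ∧
        ∃ (f' : ((qG ⁻¹ᵁ W : X'.Opens) : Scheme.{0}) ⟶ Y₁') (_ : QuasiCompact f') (_ : QuasiSeparated f')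
          (hρ' : ∀ g, (ρW g).hom ≫ f' = f'),
          f' ≫ φ = (qG ∣_ W) ≫ W.ι ∧
            ∀ y : ↥f'.normalization, HasNormalSylow ℓ (inertiaSubgroup (normalizationAction f' ρW hρ') y) := by
  classical
  haveI : X₁.IsSeparated := ⟨by rw [← terminal.comp_from f]; infer_instance⟩
  haveI : X'.IsSeparated := ⟨by rw [← terminal.comp_from (q ≫ f)]; infer_instance⟩
  let ρk : ActionOver (q ≫ f) G := ⟨ρ, fun g => by rw [← Category.assoc, hρ g]⟩
  have hcov : ∀ x : X', ∃ O : ρk.StableAffineOpens, x ∈ O.1 := exists_stableAffineOpens_mem f q ρ hρ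
  have hinj : Function.Injective ρk.aut := hfaith
  haveI : IsIntegral ρk.glued := ρk.isIntegral_glued hcov
  haveI : LocallyOfFiniteType (ρk.gluedDesc (q ≫ f) ρk.aut_comp) := ρk.locallyOfFiniteType_gluedDesc_base
  have hnormY : ∀ y : ρk.glued, IsIntegrallyClosed (ρk.glued.presheaf.stalk y) :=
    QuotientModelNormal.isIntegrallyClosed_stalk_glued_of_stalk ρk hcov hnorm
  obtain ⟨W, hWd, hWet⟩ := exists_dense_etale_gluedMk_morphismRestrict ρk hcov hinj
  haveI := hWet
  obtain ⟨ρW, hρW, Q', φ, I, hb, hfg, hdisj, f', hqc, hqs, hρ', hf', hNS⟩ :=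
    exists_admissibleBlowup_glued_forall_hasNormalSylow hAS ℓ (q ≫ f) ρk hinj hcov hnormY W hWd
  exact ⟨ρk.glued, ρk.gluedDesc (q ≫ f) ρk.aut_comp, ρk.gluedMk hcov, W, ρW, inferInstance,
    inferInstance, ρk.gluedMk_surjective hcov, ρk.gluedMk_gluedDesc hcov _ _, ρk.aut_hom_gluedMk hcov,
    fun x y hxy => ρk.exists_aut_apply_eq_of_gluedMk_eq hcov hxy, hnormY, hWd, hWet, hρW,
    Q', φ, I, hb, hfg, hdisj, f', hqc, hqs, hρ', hf', hNS⟩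

end Summit.ResolutionOfSingularities.ResolutionOfSingularities.Theorems.WildQuotientResolution.QuotientPhaseZeroNormal

end
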